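import Summits.BirchSwinnertonDyer.Rank1Residual.X11b.Three.TamagawaTwistOdd
import HarnessLib

/-!
# X11b at an ODD prime `p`: the Tamagawa bookkeeping of the Shimura road for a quadratic field of
# ANY discriminant, modulo ONE local binder at `2` (cell `b2b-bsdres`, team `x11b3`, seat `x11b3-p8`)

HONEST FRAMING (verbatim, cell `b2b-bsdres`, run/shared/lean/b2b/bsd-rank1-residual/): the goal of
the cell is to DELETE the COMBINATION-SHAPED residual classes for ALL analytic-rank `≤ 1` curves
over `ℚ` — "full BSD formula for every rank `≤ 1` curve in class `C`" assembled STRICTLY from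
published theorems — so that the rank-`≤ 1` remainder becomes exactly the CONSTRUCTION-SHAPED
classes, which are TYPED (missing-input Props), NOT attempted; this is not "finishing BSD".
Research route `p2` for class X11b at `p = 3` (team x11b3, `cells/x11b3/PLAN.md` §2 S2b); no claim
beyond the stated class and loci; nothing booked; X11 ∧ `r = 1` at `p = 3` stays CONSTRUCTION-SHAPED
(REFEREE R6.2), §I O2 OPEN. THEOREMS ONLY (no definition, no named fact, no `sorry`).

## What this file does

`Three/TamagawaTwistOdd.lean` proved the numeric Tamagawa condition of the Jetchev–Skinner–Wan field
at every odd `p` for a quadratic field of ODD discriminant. The field supplied by the tree's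
Friedberg–Hoffstein fact (`friedbergHoffstein_exists_twist_ne_zero_inertAt`, JSW §7.4.2's special
case) prescribes splitting only at the primes of `N_E`; when `E` has GOOD reduction at `2` its
discriminant may be EVEN, and then the one local Tamagawa number the tree cannot control at `p = 3`
is `c_2(E^{d_K})` (additive, wildly ramified twist of a good fibre; Kodaira–Néron only gives `≤ 4`).
This file isolates that number as ONE explicit binder and proves everything else:

* `hasGoodReductionAtPrime_twist_of_odd_of_not_dvd` — at an ODD prime `q ∤ d_K` of good reduction
  the twist keeps good reduction (unit twist, `2 ∈ ℤ_q^×`; Silverman *AEC* VII.5 Prop. 5.1(a)), so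
  `c_q(E^{d_K}) = 1` — for ANY `d_K` (the sibling file used `d_K = 4k + 1`);
* `padicValNat_localTamagawaNumber_add_twist_eq_zero_of_good_binder` — at a good prime `q` of `E`:
  `ord_p c_q(E) + ord_p c_q(E^{d_K}) = 0` for odd `p`, given (i) every ODD ramified good prime is
  `≥ 5` or `p ≥ 5`, and (ii) THE BINDER "`2 ∣ d_K ⇒ p ∤ c_2(E^{d_K})`" (asked only at `q = 2`);
* `padicValNat_tamagawaProduct_add_twist_le_of_inertSet'_binder` — the numeric condition
  `ord_p ∏c(E) + ord_p ∏c(E^{d_K}) ≤ Σ_{ℓ∈S} ord_p(ord_ℓ Δ_min(E))` for ANY `d_K`, from the sibling's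
  inert / split-of-shape lemmas, the previous bullet, the TAMAGAWA SHAPE and the binder at `2`
  (asked only when `2 ∣ d_K` and `E` is good at `2`; vacuous when `2 ∣ N_E`).

EVIDENCE for the binder at `p = 3` (never an input): kit job j120590 (PARI `elllocalred`; 240 400
twists `E^{(d)}`, `E` good at `2`, `4 ∣ d` fundamental): Kodaira types at `2` ∈ {II, II*, I₄*, I₈*},
`c_2 ∈ {1, 2, 4}`, `3 ∣ c_2` in 0 cases. A tree proof would be Tate's algorithm at `2` for ramified
quadratic twists of good fibres; not attempted here — the binder stays TYPED.

References: [SilvermanAEC2009] VII.1 Prop. 1.3, VII.5 Prop. 5.1; [SilvermanATAEC1994] IV.9.4 and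
Cor. IV.9.2; [JetchevSkinnerWan2017] §7.4.2 (arXiv:1512.06894 p. 31), §7.3.1 (eq:tamK).
-/

noncomputable section

open scoped Classical

open WeierstrassCurve NumberField IsDedekindDomain IsDedekindDomain.HeightOneSpectrum
  Literature.NumberTheory.EllipticCurves Rat.HeightOneSpectrum
  Literature.NumberTheory.EllipticCurves.Rank1Residual
  Literature.NumberTheory.DiophantineGeometry

namespace Summit.BirchSwinnertonDyer.Rank1Residual.X11b

section Good

variable (W : WeierstrassCurve ℚ) [W.IsElliptic] [W.IsGloballyMinimal]
  (K : Type) [Field K] [NumberField K]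
  {Wd : WeierstrassCurve ℚ} [Wd.IsElliptic] [Wd.IsGloballyMinimal] (Cd : VariableChange ℚ)
  (hWd : Cd • W.quadraticTwist (NumberField.discr K : ℚ) = Wd)
  (q : ℕ) [Fact q.Prime]

include hWd

omit [W.IsElliptic] [Wd.IsElliptic] [Wd.IsGloballyMinimal] in
/-- **Good reduction survives the twist at an ODD prime `q ∤ d_K`, for ANY `d_K`**: `d_K` is a
`q`-adic unit and `2 ∈ ℤ_q^×`, so `(E ⊗ ℚ_q)^{(d_K)}` is a `ℤ_q`-minimal equation
(`isMinimal_quadraticTwist`) with the same type of reduction (`hasGoodReduction_quadraticTwist_iff`),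
and a globally minimal model `Wd` of `E^{d_K}` is `ℚ_q`-isomorphic to it
(`hasGoodReduction_iff_of_isMinimal_of_eq_smul`). [cite: SilvermanAEC2009, VII.5 Prop. 5.1(a) and VII.1 Prop. 1.3(b)] -/
theorem hasGoodReductionAtPrime_twist_of_odd_of_not_dvd (hq2 : q ≠ 2)
    (hqd : ¬ (q : ℤ) ∣ NumberField.discr K) (hgood : W.HasGoodReductionAtPrime q) :
    Wd.HasGoodReductionAtPrime q := by
  set d : ℤ := NumberField.discr K with hd_def
  have hd0 : d ≠ 0 := by rw [hd_def]; exact NumberField.discr_ne_zero K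
  have hD0 : (d : ℚ) ≠ 0 := by exact_mod_cast hd0
  set u : ℤ_[q]ˣ := (isUnit_intCast_padicInt_of_not_dvd hqd).unit with hu_def
  have hu : (u : ℤ_[q]) = (d : ℤ_[q]) := rfl
  have hu' : algebraMap ℤ_[q] ℚ_[q] (u : ℤ_[q]) = algebraMap ℚ ℚ_[q] (d : ℚ) := by rw [hu]; simp
  set X : WeierstrassCurve ℚ_[q] := W.baseChange ℚ_[q] with hX
  set Y : WeierstrassCurve ℚ_[q] := Wd.baseChange ℚ_[q] with hY
  haveI hXmin : X.IsMinimal ℤ_[q] := isMinimal_map_padic_of_isGloballyMinimal W q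
  set Y' : WeierstrassCurve ℚ_[q] := X.quadraticTwist (algebraMap ℤ_[q] ℚ_[q] (u : ℤ_[q])) with hY'
  haveI hY'min : Y'.IsMinimal ℤ_[q] := isMinimal_quadraticTwist ℤ_[q] X (isUnit_two_padicInt hq2) u
  have hYY' : Y = Cd.map (algebraMap ℚ ℚ_[q]) • Y' := by
    rw [hY, ← hWd, WeierstrassCurve.VariableChange.baseChange_smul_eq (W.quadraticTwist (d : ℚ)) Cd
      ℚ_[q], baseChange, map_quadraticTwist, ← hu', hY', hX, baseChange]
  obtain ⟨C₁, hC₁⟩ : ∃ C : VariableChange ℚ_[q], X.minimal ℤ_[q] = C • X := ⟨_, rfl⟩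
  obtain ⟨C₂, hC₂⟩ : ∃ C : VariableChange ℚ_[q], Y.minimal ℤ_[q] = C • Y := ⟨_, rfl⟩
  have hC₂' : Y.minimal ℤ_[q] = (C₂ * Cd.map (algebraMap ℚ ℚ_[q])) • Y' := by rw [hC₂, hYY', mul_smul]
  have hXgood : X.HasGoodReduction ℤ_[q] :=
    (hasGoodReduction_iff_of_isMinimal_of_eq_smul ℤ_[q] hC₁).mp hgood
  have hY'good : Y'.HasGoodReduction ℤ_[q] :=
    (hasGoodReduction_quadraticTwist_iff (R := ℤ_[q]) (X := X) (d := u)).mpr hXgood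
  exact (hasGoodReduction_iff_of_isMinimal_of_eq_smul ℤ_[q] hC₂').mpr hY'good

/-- **At a prime of good reduction of `E`, `ord_p c_q(E) + ord_p c_q(E^{d_K}) = 0` for every ODD `p`
and ANY `d_K`, modulo the binder at `2`.** `c_q(E) = 1`; for the twist: `q ∤ d_K`, `q` odd — good
reduction survives (previous theorem), `c = 1`; `q = 2 ∤ d_K` — `d_K = 4k + 1`, `c = 1`
(`X2.localTamagawaNumber_twist_of_not_dvd`); `q ∣ d_K` odd — `q ≥ 5` gives Kodaira `I₀*`, `ord_p c = 0`
(`X2.padicValNat_localTamagawaNumber_twist_of_dvd`), `p ≥ 5` gives `c ≤ 4 < p` (multr1-p2);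
`q = 2 ∣ d_K` — THE BINDER `p ∤ c_2(E^{d_K})` (no tree theorem: wild twist of a good fibre).
[cite: SilvermanATAEC1994, IV.9.4 Step 6 (PDF p. 345) and Table 4.1] [cite: SilvermanAEC2009, VII.1 Prop. 1.3 and VII.5 Prop. 5.1(a)] -/
theorem padicValNat_localTamagawaNumber_add_twist_eq_zero_of_good_binder (p : ℕ) [Fact p.Prime]
    (hp2 : p ≠ 2) (h2 : Module.finrank ℚ K = 2)
    (h5 : (q : ℤ) ∣ NumberField.discr K → q ≠ 2 → 5 ≤ q ∨ 5 ≤ p)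
    (hbind : (q : ℤ) ∣ NumberField.discr K → q = 2 →
      ¬ p ∣ (Wd.baseChange ℚ_[q]).localTamagawaNumber ℤ_[q])
    (hgood : W.HasGoodReductionAtPrime q) :
    padicValNat p ((W.baseChange ℚ_[q]).localTamagawaNumber ℤ_[q]) +
      padicValNat p ((Wd.baseChange ℚ_[q]).localTamagawaNumber ℤ_[q]) = 0 := by
  -- the `p ≥ 5` escape (Kodaira–Néron `c ≤ 4 < p`, multr1-p2)
  by_cases hesc : 5 ≤ p
  · exact padicValNat_localTamagawaNumber_add_twist_eq_zero_of_good W K Cd hWd q p hesc hgood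
  set d : ℤ := NumberField.discr K with hd_def
  have hd0 : d ≠ 0 := by rw [hd_def]; exact NumberField.discr_ne_zero K
  haveI : (W.baseChange ℚ_[q]).IsElliptic := inferInstanceAs (W.map (algebraMap ℚ ℚ_[q])).IsElliptic
  haveI : (Wd.baseChange ℚ_[q]).IsElliptic := inferInstanceAs (Wd.map (algebraMap ℚ ℚ_[q])).IsElliptic
  have hcW : (W.baseChange ℚ_[q]).localTamagawaNumber ℤ_[q] = 1 := by
    haveI : ((W.baseChange ℚ_[q]).minimal ℤ_[q]).HasGoodReduction ℤ_[q] := hgood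
    exact localTamagawaNumber_eq_one_of_hasGoodReduction_holds ℤ_[q] _
  rw [hcW, padicValNat_one_right, zero_add]
  by_cases hqd : (q : ℤ) ∣ d
  · by_cases hq2 : q = 2
    · -- the binder at `2`
      exact padicValNat.eq_zero_of_not_dvd (hbind hqd hq2)
    · -- an odd ramified good prime: `q ≥ 5` (the `p ≥ 5` escape was taken above)
      have hq5 : 5 ≤ q := (h5 hqd hq2).resolve_right hesc
      have hsq : ¬ (q : ℤ) ^ 2 ∣ d :=
        Literature.NumberTheory.QuadraticFields.Quadratic.not_sq_dvd_discr_of_prime_ne_two h2 Fact.out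
          hq2
      exact X2.padicValNat_localTamagawaNumber_twist_of_dvd W p hp2 q hq5 hd0 hqd hsq hgood Cd hWd
  · by_cases hq2 : q = 2
    · -- `2 ∤ d_K`: an odd field discriminant is `≡ 1 (mod 4)`
      subst hq2
      have h1 : d % 4 = 1 := by
        rcases Literature.NumberTheory.QuadraticFields.Quadratic.isFundamentalDiscriminant_discr
          (K := K) h2 with ⟨h, -, -⟩ | ⟨h4, -, -⟩
        · exact h
        · exact absurd (dvd_trans (by norm_num : (2 : ℤ) ∣ 4) h4) (by exact_mod_cast hqd)
      have hdk : d = 4 * (d / 4) + 1 := by omega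
      rw [X2.localTamagawaNumber_twist_of_not_dvd W 2 hdk (by exact_mod_cast hqd) hgood Cd hWd,
        padicValNat_one_right]
    · -- an odd unramified good prime: good reduction survives
      have hgoodd : Wd.HasGoodReductionAtPrime q :=
        hasGoodReductionAtPrime_twist_of_odd_of_not_dvd W K Cd hWd q hq2 hqd hgood
      haveI : ((Wd.baseChange ℚ_[q]).minimal ℤ_[q]).HasGoodReduction ℤ_[q] := hgoodd
      rw [localTamagawaNumber_eq_one_of_hasGoodReduction_holds ℤ_[q] _, padicValNat_one_right]

end Good

/-! ### The numeric Tamagawa condition at the JSW field, any `d_K`, modulo the binder at `2` -/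

section Global

/-- `ord_p` of a finite product of non-zero naturals is the sum of the `ord_p`. [folklore] -/
private theorem padicValNat_finset_prod_binder (p : ℕ) [Fact p.Prime] {ι : Type*} (s : Finset ι)
    (f : ι → ℕ) (hf : ∀ i ∈ s, f i ≠ 0) :
    padicValNat p (∏ i ∈ s, f i) = ∑ i ∈ s, padicValNat p (f i) := by
  induction s using Finset.induction_on with
  | empty => simp
  | insert a s ha ih =>
    rw [Finset.prod_insert ha, Finset.sum_insert ha,
      padicValNat.mul (hf a (Finset.mem_insert_self a s))
        (Finset.prod_ne_zero_iff.mpr fun i hi => hf i (Finset.mem_insert_of_mem hi)),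
      ih fun i hi => hf i (Finset.mem_insert_of_mem hi)]

/-- **The numeric Tamagawa condition for the field of JSW §7.4.2 at every ODD `p`, ANY `d_K`, modulo
the binder at `2`**: `S` a set of multiplicative primes inert in `K`, every other bad prime split,
every split multiplicative `ℓ ∉ S` très ramifié (`p ∤ ord_ℓ Δ_min`), every ODD good `q ∣ d_K` `≥ 5`
(or `p ≥ 5`), the TAMAGAWA SHAPE "`p ∣ c_q(E) ⇒` split multiplicative", and — asked only when
`2 ∣ d_K` and `E` is good at `2` — "`p ∤ c_2(E^{d_K})`": then
`ord_p ∏c(E) + ord_p ∏c(E^{d_K}) ≤ Σ_{ℓ∈S} ord_p(ord_ℓ Δ_min(E))`. The sibling file's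
`…_le_of_inertSet'_odd` without its `2 ∤ d_K`. [cite: JetchevSkinnerWan2017, §7.4.2 (p. 31) and §7.3.1 (eq:tamK)]
[cite: SilvermanATAEC1994, IV.9.4 Steps 2, 6 and Cor. IV.9.2(d)] -/
theorem padicValNat_tamagawaProduct_add_twist_le_of_inertSet'_binder
    (W : WeierstrassCurve ℚ) [W.IsElliptic] [W.IsGloballyMinimal] (p : ℕ) [Fact p.Prime]
    (hp2 : p ≠ 2) (K : Type) [Field K] [NumberField K] (h2 : Module.finrank ℚ K = 2)
    (h5 : ∀ (q : ℕ) [Fact q.Prime], (q : ℤ) ∣ NumberField.discr K → W.HasGoodReductionAtPrime q →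
      q ≠ 2 → 5 ≤ q ∨ 5 ≤ p)
    (hshape : ∀ (q : ℕ) [Fact q.Prime], p ∣ (W.baseChange ℚ_[q]).localTamagawaNumber ℤ_[q] →
      W.HasSplitMultiplicativeReductionAtPrime q)
    {Wd : WeierstrassCurve ℚ} [Wd.IsElliptic] [Wd.IsGloballyMinimal] (Cd : VariableChange ℚ)
    (hWd : Cd • W.quadraticTwist (NumberField.discr K : ℚ) = Wd)
    -- THE binder at `2`
    (hbind : (2 : ℤ) ∣ NumberField.discr K → W.HasGoodReductionAtPrime 2 →
      ¬ p ∣ (Wd.baseChange ℚ_[2]).localTamagawaNumber ℤ_[2])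
    (S : Finset ℕ)
    (hS : ∀ ℓ ∈ S, ∃ _ : Fact ℓ.Prime, Mult W ℓ ∧
      ((ℓ ≠ 2 ∧ jacobiSym (NumberField.discr K) ℓ = -1) ∨ (ℓ = 2 ∧ NumberField.discr K % 8 = 5)))
    (hsplit : ∀ (ℓ : ℕ) [Fact ℓ.Prime], ¬ W.HasGoodReductionAtPrime ℓ → ℓ ∉ S →
      IsSquare (algebraMap ℚ ℚ_[ℓ] (NumberField.discr K : ℚ)))
    (hFC : ∀ (ℓ : ℕ) [Fact ℓ.Prime], ℓ ∉ S → W.HasSplitMultiplicativeReductionAtPrime ℓ →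
      ¬ p ∣ padicValInt ℓ W.minimalDiscriminantInt) :
    padicValNat p W.tamagawaProduct + padicValNat p Wd.tamagawaProduct ≤
      ∑ ℓ ∈ S, padicValNat p (padicValInt ℓ W.minimalDiscriminantInt) := by
  have hp : p.Prime := Fact.out
  have hfW : (W.badPlaces ℤ).Finite := W.finite_badPlaces_holds ℤ
  have hfWd : (Wd.badPlaces ℤ).Finite := Wd.finite_badPlaces_holds ℤ
  set s : Finset (HeightOneSpectrum ℤ) := hfW.toFinset ∪ hfWd.toFinset with hs
  have hsW : ∀ v, ¬ W.HasGoodReductionAt v → v ∈ s := fun v hv ↦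
    Finset.mem_union_left _ (by rw [Set.Finite.mem_toFinset, mem_badPlaces_iff]; exact hv)
  have hsWd : ∀ v, ¬ Wd.HasGoodReductionAt v → v ∈ s := fun v hv ↦
    Finset.mem_union_right _ (by rw [Set.Finite.mem_toFinset, mem_badPlaces_iff]; exact hv)
  set f : HeightOneSpectrum ℤ → ℕ := fun v ↦
    haveI := Fact.mk (primesEquiv v).2
    padicValNat p ((W.baseChange ℚ_[primesEquiv v]).localTamagawaNumber ℤ_[primesEquiv v]) +
      padicValNat p ((Wd.baseChange ℚ_[primesEquiv v]).localTamagawaNumber ℤ_[primesEquiv v]) with hf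
  set g : ℕ → ℕ := fun ℓ ↦ padicValNat p (padicValInt ℓ W.minimalDiscriminantInt) with hg
  have hterm : ∀ v : HeightOneSpectrum ℤ,
      f v ≤ if (primesEquiv v : ℕ) ∈ S then g (primesEquiv v : ℕ) else 0 := by
    intro v
    haveI := Fact.mk (primesEquiv v).2
    have key : ∀ (q : ℕ) (hq : Fact q.Prime), (primesEquiv v : ℕ) = q →
        padicValNat p (@WeierstrassCurve.localTamagawaNumber ℤ_[q] _ _ _ ℚ_[q] _ _ _ (W.baseChange ℚ_[q])) +
          padicValNat p (@WeierstrassCurve.localTamagawaNumber ℤ_[q] _ _ _ ℚ_[q] _ _ _ (Wd.baseChange ℚ_[q])) ≤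
          if q ∈ S then g q else 0 := by
      rintro q hq hvq
      by_cases hqS : q ∈ S
      · obtain ⟨_, hmult, hcase⟩ := hS q hqS
        rw [if_pos hqS, hg]
        rcases hcase with ⟨hq2, hJ⟩ | ⟨rfl, h8⟩
        · exact padicValNat_localTamagawaNumber_add_twist_le_of_inert_odd W K Cd hWd q hq2 hJ p hp2
            hmult
        · exact padicValNat_localTamagawaNumber_add_twist_le_of_inert_two_odd W K Cd hWd h8 p hp2
            hmult
      · rw [if_neg hqS, Nat.le_zero]
        by_cases hgood : W.HasGoodReductionAtPrime q
        · refine padicValNat_localTamagawaNumber_add_twist_eq_zero_of_good_binder W K Cd hWd q p hp2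
            h2 (fun hqd hq2 ↦ h5 q hqd hgood hq2) ?_ hgood
          rintro hqd rfl
          exact hbind hqd hgood
        · exact padicValNat_localTamagawaNumber_add_twist_eq_zero_of_isSquare_of_shape W K Cd hWd q p
            (hsplit q hgood hqS) (hshape q) (hFC q hqS)
    exact key _ _ rfl
  rw [tamagawaProduct_eq_prod W s hsW, tamagawaProduct_eq_prod Wd s hsWd,
    padicValNat_finset_prod_binder p s _ fun v _ ↦ ?_,
    padicValNat_finset_prod_binder p s _ fun v _ ↦ ?_, ← Finset.sum_add_distrib]
  · calc ∑ v ∈ s, f v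
        ≤ ∑ v ∈ s, (if (primesEquiv v : ℕ) ∈ S then g (primesEquiv v : ℕ) else 0) :=
          Finset.sum_le_sum fun v _ ↦ hterm v
      _ = ∑ ℓ ∈ s.image (fun v ↦ (primesEquiv v : ℕ)), (if ℓ ∈ S then g ℓ else 0) := by
          rw [Finset.sum_image]
          intro v _ w _ h
          exact primesEquiv.injective (Subtype.ext h)
      _ ≤ ∑ ℓ ∈ S, g ℓ := by
          rw [← Finset.sum_filter]
          refine Finset.sum_le_sum_of_subset_of_nonneg (fun ℓ hℓ ↦ (Finset.mem_filter.mp hℓ).2)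
            fun _ _ _ ↦ Nat.zero_le _
  · haveI := Fact.mk (primesEquiv v).2
    haveI : (W.baseChange ℚ_[primesEquiv v]).IsElliptic :=
      inferInstanceAs (W.map (algebraMap ℚ ℚ_[primesEquiv v])).IsElliptic
    exact localTamagawaNumber_padic_ne_zero_holds (primesEquiv v) _
  · haveI := Fact.mk (primesEquiv v).2
    haveI : (Wd.baseChange ℚ_[primesEquiv v]).IsElliptic :=
      inferInstanceAs (Wd.map (algebraMap ℚ ℚ_[primesEquiv v])).IsElliptic
    exact localTamagawaNumber_padic_ne_zero_holds (primesEquiv v) _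

end Global

end Summit.BirchSwinnertonDyer.Rank1Residual.X11b

end
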